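import Literature.Barriers.ValiantsHypothesis.CT23AnnihilatorPrefixColumns
import Literature.Barriers.ValiantsHypothesis.CT23ExplicitMatrixSquaring
import HarnessLib

/-!
# The explicit encoder of the annihilator matrix `M̃` (Chatterjee–Tengse arXiv:2309.07612v2,
# Lemma 3.5 = v1 Lemma 42 "Annihilator as determinant of an explicit matrix"; val-lit p2 g8,
# X-CT23 engine brick E-e′, POLYNOMIAL half)

Theorem-only (plus plumbing `def`s) companion of `CT23AnnihilatorPrefixColumns.lean` (prefix
columns, this seat), `CT23KroneckerEvaluationPoints.lean` / `CT23AnnihilatorAsDeterminant.lean`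
(t18 g7: the matrix `M̃ = annMatrix`) and `CT23ExplicitMatrixSquaring.lean` (t18 g7: Def. 2.27
`matOf a b E`, an encoder polynomial `E` with two index blocks `a, b`); NO named facts. Honest
framing: bookkeeping for the source's `VPSPACE` upper bound on annihilators (consequences-side
literature); it discharges nothing by itself; `VP ≠ VNP` is NOT proved and nothing here bears on it.

## The printed construction (v1 p0015.txt:L80–L102, p0016.txt:L1–L8)

"`pow(i) := ( ∏_ℓ (i_ℓ · C_{ℓ,0}(α) + (1 − i_ℓ) · 1), …, ∏_ℓ (i_ℓ · C_{ℓ,m−1}(α) + (1 − i_ℓ) · 1) )`,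
`ROW(i) := LT(i, k) · C_G(pow(i)) + EQ(i, k) · x`,
`M̃_G(i, j) := ∏_{a ∈ [n]} ∏_{b = 0}^{δ−1} ( C'_{a,b}(j) · (ROW(i)_a)^{2^b} + (1 − C'_{a,b}(j)) · 1 )`.
Here `pow(i)` computes the vector `v_{α,i}`, … `k` is the binary encoding of the integer `K−1`
and `ROW(i)_a = LT(i,k) · g_a(pow(i)) + EQ(i,k) · x_a`."

## Rendering (one variable type `τ`; `x : Fin n → τ` the annihilator variables, `a b : Fin L → τ`
## the row / column index blocks, `L = n·δ`; all distinct: `EncLayout`)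

* `kronPow a α Δ k` = `pow(i)_k` (the `k`-th coordinate `α^{(val i + 1) Δ^k}` of the Kronecker
  point of t18's `kronPoint Δ (α^{val i + 1})`; little-endian row bits, `BitGadget.bitsVal`);
* `gAt a α Δ U c` = `g_t(pow(i))` through the ENCODING polynomial `U(z, y)` of `G` (Def. 1.7,
  `Encodes`: `U(z, c_t) = g_t`) — `U` with `z ↦ pow`, `y ↦ c_t`;
* `rowPoly` = `ROW(i)_t`, with `k` = the bits of `K` (the tree's `annMatrix` puts the symbolic row
  LAST, at index `K`, the `K` evaluation rows first — the source's `K−1` after its index shift);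
* `colPow` = the inner product over the bits of block `t` of `j` (NO decoding circuit `C'`: the
  box side is a power of two and block `t` of `j` IS the binary expansion of the exponent `e_t`,
  `blockExp` of the prefix-columns file — disclosed deviation), `corePoly = ∏_t colPow`;
* `annEnc` = `act(a)·act(b)·core + (1 − act(b))·EQ(a, b)` with `act = 1 − GT(·, k)`: the source's
  matrix is `K+1 × K+1`; Prop. 2.28 wants a `2^L × 2^L` matrix indexed by ALL bit-vectors, so the
  inactive indices (`val > K`) are PADDED by an identity block (disclosed; determinant unchanged).

Results: the gadget / block semantics under the bit substitution of `matOf` (`bitSubst_*`,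
`aeval_bitSubst_EQ/LT/GT/kronPow/gAt/rowPoly/colPow/corePoly`), **`matOf_annEnc`**: the encoded
matrix is `padMatrix K (rename x ∘ annMatrix N e)` with t18's `annMatrix`, rows the Kronecker
evaluations `N i j = (G^{e j})(kronPoint Δ (α^{i+1}))` and columns `e = blockEnum n δ ∘ castLE`,
and **`det_matOf_annEnc`**: `det (matOf a b annEnc) = rename x (det M̃)` (`det_padMatrix`: block
triangular after reindexing the bit-vectors by their value). With
`exists_prefix_annihilator_blocks` (prefix-columns file) this `det` is a nonzero annihilator of `G`
of individual degree `< 2^δ ≤ 3md` — the CIRCUIT for `annEnc` (size `n·|C_G| + poly`) is the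
sibling brick (file 3 of E-e′), and Prop. 2.28 (bricks E-c/E-c′/E-d) turns it into a projection
circuit for the determinant.

## References

* [ChatterjeeTengse2023] P. Chatterjee, A. Tengse, *Lower Bounds from Succinct Hitting Sets*,
  arXiv:2309.07612v2, Lemma 3.5 and its proof, Def. 2.27 (v1: Lemma 42, p0015.txt:L57–L102,
  p0016.txt:L1–L8; Def. 34, p0011.txt:L82).
* Tree: `CT23AnnihilatorAsDeterminant.lean`, `CT23KroneckerEvaluationPoints.lean`,
  `CT23ExplicitMatrixSquaring.lean` (val-lit t18 g7); `BooleanGadgetPolynomials.lean` (val-lit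
  t24 g9: `BitGadget.EQ/LT/GT`, `map_*_eq_indicator`); `CT23AnnihilatorPrefixColumns.lean`.
-/

noncomputable section

open MvPolynomial Matrix

namespace Literature.Barriers.ValiantsHypothesis

namespace CT23Encoder

open Literature.Computability.AlgebraicComplexity BitGadget

universe u v

variable {F : Type u} [Field F] {τ : Type v} [DecidableEq τ]

/-! ### Layout of the variables and the bit substitution of `matOf` -/

section Layout

variable {n L : ℕ}

/-- The annihilator variables `x`, the row block `a` and the column block `b` are distinct
variables (one injective map). [cite: ChatterjeeTengse2023, Lemma 3.5 / Def. 2.27 (v1: Lemma 42, Def. 34; p0015.txt:L80–L82)] -/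
structure EncLayout (x : Fin n → τ) (a b : Fin L → τ) : Prop where
  /-- `x, a, b` are pairwise distinct variables -/
  inj : Function.Injective (Sum.elim x (Sum.elim a b))

namespace EncLayout

variable {x : Fin n → τ} {a b : Fin L → τ} (lay : EncLayout x a b)
include lay

omit [DecidableEq τ] in
/-- `x` is injective. [cite: ChatterjeeTengse2023, Lemma 3.5 (v1: Lemma 42; p0015.txt:L80–L82)] -/
theorem x_inj : Function.Injective x := fun t t' h => by
  have := @lay.inj (Sum.inl t) (Sum.inl t') (by simpa using h)
  simpa using this

omit [DecidableEq τ] in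
/-- `a` is injective. [cite: ChatterjeeTengse2023, Lemma 3.5 (v1: Lemma 42; p0015.txt:L80–L82)] -/
theorem a_inj : Function.Injective a := fun l l' h => by
  have := @lay.inj (Sum.inr (Sum.inl l)) (Sum.inr (Sum.inl l')) (by simpa using h)
  simpa using this

omit [DecidableEq τ] in
/-- `b` is injective. [cite: ChatterjeeTengse2023, Lemma 3.5 (v1: Lemma 42; p0015.txt:L80–L82)] -/
theorem b_inj : Function.Injective b := fun l l' h => by
  have := @lay.inj (Sum.inr (Sum.inr l)) (Sum.inr (Sum.inr l')) (by simpa using h)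
  simpa using this

omit [DecidableEq τ] in
/-- `a` misses `x`. [cite: ChatterjeeTengse2023, Lemma 3.5 (v1: Lemma 42; p0015.txt:L80–L82)] -/
theorem a_ne_x (l : Fin L) (t : Fin n) : a l ≠ x t := fun h => by
  have := @lay.inj (Sum.inr (Sum.inl l)) (Sum.inl t) (by simpa using h)
  simp at this

omit [DecidableEq τ] in
/-- `b` misses `x`. [cite: ChatterjeeTengse2023, Lemma 3.5 (v1: Lemma 42; p0015.txt:L80–L82)] -/
theorem b_ne_x (l : Fin L) (t : Fin n) : b l ≠ x t := fun h => by
  have := @lay.inj (Sum.inr (Sum.inr l)) (Sum.inl t) (by simpa using h)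
  simp at this

omit [DecidableEq τ] in
/-- `a` misses `b`. [cite: ChatterjeeTengse2023, Lemma 3.5 (v1: Lemma 42; p0015.txt:L80–L82)] -/
theorem a_ne_b (l l' : Fin L) : a l ≠ b l' := fun h => by
  have := @lay.inj (Sum.inr (Sum.inl l)) (Sum.inr (Sum.inr l')) (by simpa using h)
  simp at this

end EncLayout

variable (a b : Fin L → τ)

/-- The substitution of Def. 2.27 / `matOf`: the bits `βa` for the block `a`, `βb` for `b`,
every other variable fixed. [cite: ChatterjeeTengse2023, Def. 2.27 (v1: Def. 34; p0011.txt:L82)] -/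
def bitSubst (βa βb : Fin L → Bool) : τ → MvPolynomial τ F :=
  onBlock a (fun l => bit (βa l)) (onBlock b (fun l => bit (βb l)) X)

/-- `matOf` is the bit substitution, entrywise. [cite: ChatterjeeTengse2023, Def. 2.27 (v1: Def. 34; p0011.txt:L82)] -/
theorem matOf_apply' (E : MvPolynomial τ F) (βa βb : Fin L → Bool) :
    matOf a b E βa βb = aeval (bitSubst (F := F) a b βa βb) E := rfl

variable {a b} {x : Fin n → τ}

omit [DecidableEq τ] in
/-- E-c's `bit` is E-b's `bitVal`. [cite: ChatterjeeTengse2023, Def. 2.27 and Obs. 2.9 (v1: Def. 34, Obs. 17)] -/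
@[simp] theorem bit_eq_bitVal (c : Bool) : (bit c : MvPolynomial τ F) = bitVal c := by
  cases c <;> rfl

/-- On the row block. [cite: ChatterjeeTengse2023, Def. 2.27 (v1: Def. 34; p0011.txt:L82)] -/
theorem bitSubst_a (lay : EncLayout x a b) (βa βb : Fin L → Bool) (l : Fin L) :
    bitSubst (F := F) a b βa βb (a l) = bitVal (βa l) := by
  rw [bitSubst, onBlock_blk lay.a_inj, bit_eq_bitVal]

/-- On the column block. [cite: ChatterjeeTengse2023, Def. 2.27 (v1: Def. 34; p0011.txt:L82)] -/
theorem bitSubst_b (lay : EncLayout x a b) (βa βb : Fin L → Bool) (l : Fin L) :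
    bitSubst (F := F) a b βa βb (b l) = bitVal (βb l) := by
  rw [bitSubst, onBlock_of_ne (fun l' => lay.a_ne_b l' l), onBlock_blk lay.b_inj, bit_eq_bitVal]

/-- On the annihilator variables. [cite: ChatterjeeTengse2023, Def. 2.27 (v1: Def. 34; p0011.txt:L82)] -/
theorem bitSubst_x (lay : EncLayout x a b) (βa βb : Fin L → Bool) (t : Fin n) :
    bitSubst (F := F) a b βa βb (x t) = X (x t) := by
  rw [bitSubst, onBlock_of_ne (fun l => lay.a_ne_x l t), onBlock_of_ne (fun l => lay.b_ne_x l t)]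

end Layout

/-! ### Bit-vector bookkeeping: the value of a bit-vector as a sum, the bits of `K` -/

section Bits

variable {L : ℕ}

/-- `val(β) = Σ_l β_l 2^l` (little-endian). [cite: ChatterjeeTengse2023, Obs. 2.9 "binary encodings" (v1: Obs. 17)] -/
theorem bitsVal_eq_sum : ∀ (L : ℕ) (β : Fin L → Bool),
    bitsVal L β = ∑ l : Fin L, (β l).toNat * 2 ^ (l : ℕ)
  | 0, β => by simp [bitsVal]
  | L + 1, β => by
    rw [bitsVal, Fin.sum_univ_succ, bitsVal_eq_sum L (Fin.tail β), Finset.mul_sum]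
    simp only [Fin.val_zero, pow_zero, mul_one, Fin.val_succ, pow_succ, Fin.tail]
    congr 1
    exact Finset.sum_congr rfl fun l _ => by ring

/-- **The bits of `K`** (`K < 2^L`): the source's constant vector `k`. [cite: ChatterjeeTengse2023, Lemma 3.5 "`k` is the binary encoding of the integer `K−1`" (v1: Lemma 42; p0016.txt:L2)] -/
def natBits (L K : ℕ) (hK : K < 2 ^ L) : Fin L → Bool := (bitsIndex L).symm ⟨K, hK⟩

/-- The bits of `K` encode `K`. [cite: ChatterjeeTengse2023, Lemma 3.5 (v1: Lemma 42; p0016.txt:L2)] -/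
@[simp] theorem bitsVal_natBits (L K : ℕ) (hK : K < 2 ^ L) : bitsVal L (natBits L K hK) = K := by
  rw [natBits, ← bitsIndex_apply_val, Equiv.apply_symm_apply]

/-- A bit-vector equals the bits of `K` iff its value is `K`. [cite: ChatterjeeTengse2023, Lemma 3.5 (v1: Lemma 42; p0016.txt:L2)] -/
theorem eq_natBits_iff {K : ℕ} (hK : K < 2 ^ L) (β : Fin L → Bool) :
    β = natBits L K hK ↔ bitsVal L β = K := by
  constructor
  · rintro rfl; exact bitsVal_natBits L K hK
  · intro h
    exact bitsVal_injective L (by rw [h, bitsVal_natBits])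

end Bits

/-! ### The gadgets and blocks of the encoder, and their values under the bit substitution -/

section Gadgets

variable {n m r L : ℕ} {x : Fin n → τ} {a b : Fin L → τ}

/-- The row block as gadget inputs. [cite: ChatterjeeTengse2023, Lemma 3.5 (v1: Lemma 42; p0015.txt:L96–L99)] -/
def varVec (a : Fin L → τ) : Fin L → MvPolynomial τ F := fun l => X (a l)

/-- A constant bit-vector as gadget inputs. [cite: ChatterjeeTengse2023, Lemma 3.5 (v1: Lemma 42; p0016.txt:L2)] -/
def constVec (Kb : Fin L → Bool) : Fin L → MvPolynomial τ F := fun l => bitVal (Kb l)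

omit [DecidableEq τ] in
/-- Algebra maps commute with `EQ` (E-b's `map_EQ`). [cite: ChatterjeeTengse2023, Obs. 2.9 (v1: Obs. 17)] -/
theorem aeval_EQ (f : τ → MvPolynomial τ F) (u v : Fin L → MvPolynomial τ F) :
    aeval f (EQ L u v) = EQ L (fun i => aeval f (u i)) (fun i => aeval f (v i)) := by
  simpa [Function.comp_def] using
    map_EQ ((aeval f : MvPolynomial τ F →ₐ[F] MvPolynomial τ F) : MvPolynomial τ F →+* MvPolynomial τ F) L u v

omit [DecidableEq τ] in
/-- Algebra maps commute with `LT` (E-b's `map_LT`). [cite: ChatterjeeTengse2023, Obs. 2.9 (v1: Obs. 17)] -/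
theorem aeval_LT (f : τ → MvPolynomial τ F) (u v : Fin L → MvPolynomial τ F) :
    aeval f (LT L u v) = LT L (fun i => aeval f (u i)) (fun i => aeval f (v i)) := by
  simpa [Function.comp_def] using
    map_LT ((aeval f : MvPolynomial τ F →ₐ[F] MvPolynomial τ F) : MvPolynomial τ F →+* MvPolynomial τ F) L u v

omit [DecidableEq τ] in
/-- Algebra maps commute with `GT` (E-b's `map_GT`). [cite: ChatterjeeTengse2023, Obs. 2.9 (v1: Obs. 17)] -/
theorem aeval_GT (f : τ → MvPolynomial τ F) (u v : Fin L → MvPolynomial τ F) :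
    aeval f (GT L u v) = GT L (fun i => aeval f (u i)) (fun i => aeval f (v i)) := by
  simpa [Function.comp_def] using
    map_GT ((aeval f : MvPolynomial τ F →ₐ[F] MvPolynomial τ F) : MvPolynomial τ F →+* MvPolynomial τ F) L u v

omit [DecidableEq τ] in
/-- Constant gadget entries are fixed by every algebra map. [folklore] -/
private theorem aeval_constVec (f : τ → MvPolynomial τ F) (Kb : Fin L → Bool) (l : Fin L) :
    aeval f (constVec (F := F) (τ := τ) Kb l) = bitVal (Kb l) := by
  cases h : Kb l <;> simp [constVec, bitVal, h]

/-- The row block under the bit substitution, as gadget inputs. [cite: ChatterjeeTengse2023, Def. 2.27 (v1: Def. 34)] -/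
private theorem aeval_varVec_a (lay : EncLayout x a b) (βa βb : Fin L → Bool) :
    (fun l => aeval (bitSubst (F := F) a b βa βb) (varVec (F := F) a l)) =
      fun l => (bitVal (βa l) : MvPolynomial τ F) := by
  funext l; rw [varVec, aeval_X, bitSubst_a lay]

/-- The column block under the bit substitution, as gadget inputs. [cite: ChatterjeeTengse2023, Def. 2.27 (v1: Def. 34)] -/
private theorem aeval_varVec_b (lay : EncLayout x a b) (βa βb : Fin L → Bool) :
    (fun l => aeval (bitSubst (F := F) a b βa βb) (varVec (F := F) b l)) =
      fun l => (bitVal (βb l) : MvPolynomial τ F) := by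
  funext l; rw [varVec, aeval_X, bitSubst_b lay]

omit [DecidableEq τ] in
/-- A constant vector under any algebra map, as gadget inputs. [folklore] -/
private theorem aeval_constVec_fun (f : τ → MvPolynomial τ F) (Kb : Fin L → Bool) :
    (fun l => aeval f (constVec (F := F) (τ := τ) Kb l)) =
      fun l => (bitVal (Kb l) : MvPolynomial τ F) := by
  funext l; exact aeval_constVec f Kb l

/-- **`EQ(a, k)` under the bit substitution** = `[val a = K]`.
[cite: ChatterjeeTengse2023, Lemma 3.5 and Obs. 2.9 (v1: Lemma 42, p0015.txt:L97; Obs. 17)] -/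
theorem aeval_bitSubst_EQ_const (lay : EncLayout x a b) (βa βb : Fin L → Bool) {K : ℕ}
    (hK : K < 2 ^ L) :
    aeval (bitSubst (F := F) a b βa βb) (EQ L (varVec (F := F) a) (constVec (natBits L K hK))) =
      bitVal (decide (bitsVal L βa = K)) := by
  rw [aeval_EQ, aeval_varVec_a lay, aeval_constVec_fun, EQ_bitVal]
  congr 1
  rw [decide_eq_decide, eq_natBits_iff]

/-- **`LT(a, k)` under the bit substitution** = `[val a < K]`.
[cite: ChatterjeeTengse2023, Lemma 3.5 and Obs. 2.9 (v1: Lemma 42, p0015.txt:L97; Obs. 17)] -/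
theorem aeval_bitSubst_LT_const (lay : EncLayout x a b) (βa βb : Fin L → Bool) {K : ℕ}
    (hK : K < 2 ^ L) :
    aeval (bitSubst (F := F) a b βa βb) (LT L (varVec (F := F) a) (constVec (natBits L K hK))) =
      bitVal (decide (bitsVal L βa < K)) := by
  rw [aeval_LT, aeval_varVec_a lay, aeval_constVec_fun, LT_bitVal, bitsVal_natBits]

/-- **`GT(a, k)` under the bit substitution** = `[K < val a]` (row block).
[cite: ChatterjeeTengse2023, Lemma 3.5 and Obs. 2.9 (v1: Lemma 42; Obs. 17)] -/
theorem aeval_bitSubst_GT_const_a (lay : EncLayout x a b) (βa βb : Fin L → Bool) {K : ℕ}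
    (hK : K < 2 ^ L) :
    aeval (bitSubst (F := F) a b βa βb) (GT L (varVec (F := F) a) (constVec (natBits L K hK))) =
      bitVal (decide (K < bitsVal L βa)) := by
  rw [aeval_GT, aeval_varVec_a lay, aeval_constVec_fun, GT_bitVal, bitsVal_natBits]

/-- **`GT(b, k)` under the bit substitution** = `[K < val b]` (column block).
[cite: ChatterjeeTengse2023, Lemma 3.5 and Obs. 2.9 (v1: Lemma 42; Obs. 17)] -/
theorem aeval_bitSubst_GT_const_b (lay : EncLayout x a b) (βa βb : Fin L → Bool) {K : ℕ}
    (hK : K < 2 ^ L) :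
    aeval (bitSubst (F := F) a b βa βb) (GT L (varVec (F := F) b) (constVec (natBits L K hK))) =
      bitVal (decide (K < bitsVal L βb)) := by
  rw [aeval_GT, aeval_varVec_b lay, aeval_constVec_fun, GT_bitVal, bitsVal_natBits]

/-- **`EQ(a, b)` under the bit substitution** = `[a = b]` (the identity padding).
[cite: ChatterjeeTengse2023, Lemma 3.5 and Obs. 2.9 (v1: Lemma 42; Obs. 17)] -/
theorem aeval_bitSubst_EQ_ab (lay : EncLayout x a b) (βa βb : Fin L → Bool) :
    aeval (bitSubst (F := F) a b βa βb) (EQ L (varVec (F := F) a) (varVec b)) =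
      bitVal (decide (βa = βb)) := by
  rw [aeval_EQ, aeval_varVec_a lay, aeval_varVec_b lay, EQ_bitVal]

/-- **`pow(i)_k`** — the `k`-th coordinate of the Kronecker point of row `i`, by repeated
squaring on the row bits: `α^{Δ^k} · ∏_ℓ (i_ℓ · α^{2^ℓ Δ^k} + (1 − i_ℓ))`.
[cite: ChatterjeeTengse2023, Lemma 3.5, `pow(i)` (v1: Lemma 42; p0015.txt:L86–L96)] -/
def kronPow (a : Fin L → τ) (α : F) (Δ : ℕ) (k : Fin m) : MvPolynomial τ F :=
  C (α ^ Δ ^ (k : ℕ)) *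
    ∏ l : Fin L, (X (a l) * C (α ^ (2 ^ (l : ℕ) * Δ ^ (k : ℕ))) + (1 - X (a l)))

/-- A selected power: on a bit, `c · q + (1 − c)` is `q` or `1`. [folklore] -/
private theorem bitVal_mul_add_one_sub {R : Type*} [CommRing R] (c : Bool) (q : R) :
    (bitVal c : R) * q + (1 - bitVal c) = if c then q else 1 := by
  cases c <;> simp [bitVal]

/-- **`pow(i)` is the Kronecker point**: under the bit substitution, `kronPow` is the constant
`kronPoint Δ (α^{val i + 1}) k` ("`pow(i)` computes the vector `v_{α,i}`"; the tree's evaluation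
rows are at `α^{i+1}`). [cite: ChatterjeeTengse2023, Lemma 3.5 (v1: Lemma 42; p0016.txt:L1)] -/
theorem aeval_bitSubst_kronPow (lay : EncLayout x a b) (βa βb : Fin L → Bool) (α : F) (Δ : ℕ)
    (k : Fin m) :
    aeval (bitSubst (F := F) a b βa βb) (kronPow a α Δ k) =
      C (kronPoint Δ (α ^ (bitsVal L βa + 1)) k) := by
  rw [kronPow, map_mul, map_prod]
  have hfac : ∀ l : Fin L, aeval (bitSubst (F := F) a b βa βb)
      ((X (a l) * C (α ^ (2 ^ (l : ℕ) * Δ ^ (k : ℕ))) + (1 - X (a l)))) =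
      C (if βa l then α ^ (2 ^ (l : ℕ) * Δ ^ (k : ℕ)) else 1) := by
    intro l
    rw [map_add, map_mul, map_sub, map_one, aeval_X, aeval_C, bitSubst_a (F := F) lay,
      algebraMap_eq, bitVal_mul_add_one_sub]
    split_ifs <;> simp
  simp_rw [hfac]
  have hprod : (∏ l : Fin L, (if βa l then α ^ (2 ^ (l : ℕ) * Δ ^ (k : ℕ)) else (1 : F))) =
      α ^ (bitsVal L βa * Δ ^ (k : ℕ)) := by
    rw [bitsVal_eq_sum, Finset.sum_mul, ← Finset.prod_pow_eq_pow_sum]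
    refine Finset.prod_congr rfl fun l _ => ?_
    cases βa l <;> simp
  rw [← map_prod C, hprod, aeval_C, algebraMap_eq, ← map_mul, ← pow_add, kronPoint, ← pow_mul]
  congr 2
  ring

omit [DecidableEq τ] in
/-- Evaluating after substituting is evaluating at the evaluated substitution. [folklore] -/
private theorem eval_aeval_eq {σ ι : Type*} (p : ι → F) (s : σ → MvPolynomial ι F)
    (U : MvPolynomial σ F) : eval p (aeval s U) = eval (fun i => eval p (s i)) U := by
  induction U using MvPolynomial.induction_on with
  | C c => simp
  | add p q hp hq => rw [map_add, map_add, hp, hq, map_add]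
  | mul_X q i hq => rw [map_mul, map_mul, hq, aeval_X, map_mul, eval_X]

omit [DecidableEq τ] in
/-- Substituting constants is evaluation followed by `C`. [folklore] -/
private theorem aeval_C_comp {σ : Type*} (v : σ → F) (p : MvPolynomial σ F) :
    aeval (fun i => (C (v i) : MvPolynomial τ F)) p = C (eval v p) := by
  induction p using MvPolynomial.induction_on with
  | C c => simp
  | add p q hp hq => rw [map_add, map_add, hp, hq, map_add]
  | mul_X p i hp => rw [map_mul, hp, aeval_X, map_mul, eval_X, map_mul]

/-- **`g_t(pow(i))`** through the encoding polynomial `U(z, y)` of `G` (Def. 1.7: `U(z, c_t) = g_t`):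
`U` with `z ↦ pow(i)`, `y ↦ c_t`. [cite: ChatterjeeTengse2023, Lemma 3.5, `C_G(pow(i))` (v1: Lemma 42; p0015.txt:L97, p0016.txt:L3)] -/
def gAt (a : Fin L → τ) (α : F) (Δ : ℕ) (U : MvPolynomial (Fin m ⊕ Fin r) F) (c : Fin r → F) :
    MvPolynomial τ F :=
  aeval (Sum.elim (fun k => kronPow a α Δ k) (fun j => C (c j))) U

/-- **`g_t(pow(i))` is the evaluation of `g_t` at the Kronecker point** (as a constant), when
`U(z, c) = g`. [cite: ChatterjeeTengse2023, Lemma 3.5 (v1: Lemma 42; p0016.txt:L3)] -/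
theorem aeval_bitSubst_gAt (lay : EncLayout x a b) (βa βb : Fin L → Bool) (α : F) (Δ : ℕ)
    {U : MvPolynomial (Fin m ⊕ Fin r) F} {c : Fin r → F} {g : MvPolynomial (Fin m) F}
    (hc : aeval (Sum.elim X fun j => C (c j)) U = g) :
    aeval (bitSubst (F := F) a b βa βb) (gAt a α Δ U c) =
      C (eval (kronPoint Δ (α ^ (bitsVal L βa + 1))) g) := by
  rw [gAt, ← AlgHom.comp_apply, comp_aeval]
  have hs : (fun i : Fin m ⊕ Fin r => aeval (bitSubst (F := F) a b βa βb)
      (Sum.elim (fun k => kronPow a α Δ k) (fun j => C (c j)) i)) =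
      fun i : Fin m ⊕ Fin r => C (Sum.elim (kronPoint Δ (α ^ (bitsVal L βa + 1)) : Fin m → F) c i) := by
    funext i
    cases i with
    | inl k => simp only [Sum.elim_inl]; exact aeval_bitSubst_kronPow lay βa βb α Δ k
    | inr j => simp
  rw [hs, aeval_C_comp, ← hc, eval_aeval_eq]
  congr 1
  have hv : (fun i : Fin m ⊕ Fin r => eval (kronPoint Δ (α ^ (bitsVal L βa + 1)))
      (Sum.elim X (fun j => C (c j)) i)) = Sum.elim (kronPoint Δ (α ^ (bitsVal L βa + 1))) c := by
    funext i
    cases i with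
    | inl k => simp
    | inr j => simp
  rw [hv]

end Gadgets

/-! ### `ROW`, the column powers, the core entry and the padded encoder -/

section Encoder

variable {n m r δ : ℕ} {x : Fin n → τ} {a b : Fin (n * δ) → τ}

/-- **`ROW(i)_t := LT(i,k) · g_t(pow(i)) + EQ(i,k) · x_t`**: an evaluation row below `K`, the
symbolic row at `K`. [cite: ChatterjeeTengse2023, Lemma 3.5, `ROW` (v1: Lemma 42; p0015.txt:L97, p0016.txt:L2–L3)] -/
def rowPoly (x : Fin n → τ) (a : Fin (n * δ) → τ) (Kb : Fin (n * δ) → Bool) (α : F) (Δ : ℕ)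
    (U : MvPolynomial (Fin m ⊕ Fin r) F) (c : Fin n → Fin r → F) (t : Fin n) : MvPolynomial τ F :=
  LT (n * δ) (varVec a) (constVec Kb) * gAt a α Δ U (c t) +
    EQ (n * δ) (varVec a) (constVec Kb) * X (x t)

/-- **`ROW` under the bit substitution**: `[val i < K] · g_t(v_{α,i}) + [val i = K] · x_t`.
[cite: ChatterjeeTengse2023, Lemma 3.5 (v1: Lemma 42; p0016.txt:L2–L3)] -/
theorem aeval_bitSubst_rowPoly (lay : EncLayout x a b) (βa βb : Fin (n * δ) → Bool) {K : ℕ}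
    (hK : K < 2 ^ (n * δ)) (α : F) (Δ : ℕ) {U : MvPolynomial (Fin m ⊕ Fin r) F}
    {c : Fin n → Fin r → F} {G : Fin n → MvPolynomial (Fin m) F}
    (hc : ∀ t, aeval (Sum.elim X fun j => C (c t j)) U = G t) (t : Fin n) :
    aeval (bitSubst (F := F) a b βa βb) (rowPoly x a (natBits _ K hK) α Δ U c t) =
      bitVal (decide (bitsVal _ βa < K)) *
          C (eval (kronPoint Δ (α ^ (bitsVal _ βa + 1))) (G t)) +
        bitVal (decide (bitsVal _ βa = K)) * X (x t) := by
  rw [rowPoly, map_add, map_mul, map_mul, aeval_bitSubst_LT_const lay, aeval_bitSubst_gAt lay _ _ _ _ (hc t),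
    aeval_bitSubst_EQ_const lay, aeval_X, bitSubst_x lay]

/-- **The inner product of Lemma 3.5 over the bits of block `t` of the column index**:
`∏_{β < δ} ( j_{t,β} · R^{2^β} + (1 − j_{t,β}) )` — raises `R` to the digit `e_t(j)`.
[cite: ChatterjeeTengse2023, Lemma 3.5, `M̃_G(i,j)` (v1: Lemma 42; p0015.txt:L99)] -/
def colPow (b : Fin (n * δ) → τ) (R : MvPolynomial τ F) (t : Fin n) : MvPolynomial τ F :=
  ∏ β : Fin δ, (X (b (finProdFinEquiv (t, β))) * R ^ (2 ^ (β : ℕ)) + (1 - X (b (finProdFinEquiv (t, β)))))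

/-- **The column power under the bit substitution** is `R^{e_t(j)}` with `e_t(j)` the digit read
off block `t` (`blockExp`). [cite: ChatterjeeTengse2023, Lemma 3.5 (v1: Lemma 42; p0015.txt:L99)] -/
theorem aeval_bitSubst_colPow (lay : EncLayout x a b) (βa βb : Fin (n * δ) → Bool)
    (R : MvPolynomial τ F) (t : Fin n) :
    aeval (bitSubst (F := F) a b βa βb) (colPow b R t) =
      (aeval (bitSubst (F := F) a b βa βb) R) ^ (blockExp n δ βb t) := by
  rw [colPow, map_prod]
  have hfac : ∀ β : Fin δ, aeval (bitSubst (F := F) a b βa βb)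
      (X (b (finProdFinEquiv (t, β))) * R ^ (2 ^ (β : ℕ)) + (1 - X (b (finProdFinEquiv (t, β))))) =
      (aeval (bitSubst (F := F) a b βa βb) R) ^ ((βb (finProdFinEquiv (t, β))).toNat * 2 ^ (β : ℕ)) := by
    intro β
    rw [map_add, map_mul, map_sub, map_one, aeval_X, bitSubst_b (F := F) lay, map_pow,
      bitVal_mul_add_one_sub]
    cases βb (finProdFinEquiv (t, β)) <;> simp
  simp_rw [hfac]
  rw [Finset.prod_pow_eq_pow_sum, blockExp_apply, bitsVal_eq_sum]
  rfl

/-- **The core entry `∏_t ∏_β (…)`** of Lemma 3.5. [cite: ChatterjeeTengse2023, Lemma 3.5, `M̃_G(i,j)` (v1: Lemma 42; p0015.txt:L99)] -/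
def corePoly (x : Fin n → τ) (a b : Fin (n * δ) → τ) (Kb : Fin (n * δ) → Bool) (α : F) (Δ : ℕ)
    (U : MvPolynomial (Fin m ⊕ Fin r) F) (c : Fin n → Fin r → F) : MvPolynomial τ F :=
  ∏ t : Fin n, colPow b (rowPoly x a Kb α Δ U c t) t

/-- **The core entry on an EVALUATION row** (`val i < K`): `(G(v_{α,i}))^{e(j)}` as a constant.
[cite: ChatterjeeTengse2023, Lemma 3.5 / Lemma 3.2 (v1: Lemma 42, p0015.txt:L62–L64)] -/
theorem aeval_bitSubst_corePoly_lt (lay : EncLayout x a b) (βa βb : Fin (n * δ) → Bool) {K : ℕ}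
    (hK : K < 2 ^ (n * δ)) (α : F) (Δ : ℕ) {U : MvPolynomial (Fin m ⊕ Fin r) F}
    {c : Fin n → Fin r → F} {G : Fin n → MvPolynomial (Fin m) F}
    (hc : ∀ t, aeval (Sum.elim X fun j => C (c t j)) U = G t) (hlt : bitsVal _ βa < K) :
    aeval (bitSubst (F := F) a b βa βb) (corePoly x a b (natBits _ K hK) α Δ U c) =
      C (eval (kronPoint Δ (α ^ (bitsVal _ βa + 1))) (∏ t, G t ^ blockExp n δ βb t)) := by
  rw [corePoly, map_prod, map_prod, map_prod]
  refine Finset.prod_congr rfl fun t _ => ?_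
  rw [aeval_bitSubst_colPow lay, aeval_bitSubst_rowPoly lay βa βb hK α Δ hc, map_pow, map_pow]
  have hne : bitsVal _ βa ≠ K := hlt.ne
  simp [hlt, hne]

/-- **The core entry on the SYMBOLIC row** (`val i = K`): the monomial `x^{e(j)}`.
[cite: ChatterjeeTengse2023, Lemma 3.5 / Lemma 3.2 (v1: Lemma 42, p0015.txt:L62–L64)] -/
theorem aeval_bitSubst_corePoly_eq (lay : EncLayout x a b) (βa βb : Fin (n * δ) → Bool) {K : ℕ}
    (hK : K < 2 ^ (n * δ)) (α : F) (Δ : ℕ) {U : MvPolynomial (Fin m ⊕ Fin r) F}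
    {c : Fin n → Fin r → F} {G : Fin n → MvPolynomial (Fin m) F}
    (hc : ∀ t, aeval (Sum.elim X fun j => C (c t j)) U = G t) (heq : bitsVal _ βa = K) :
    aeval (bitSubst (F := F) a b βa βb) (corePoly x a b (natBits _ K hK) α Δ U c) =
      rename x (monomial (blockExp n δ βb) 1) := by
  rw [corePoly, map_prod]
  have hmon : rename x (monomial (blockExp n δ βb) (1 : F)) = ∏ t, X (x t) ^ blockExp n δ βb t := by
    rw [monomial_eq, map_one, one_mul, Finsupp.prod_pow, map_prod]
    simp
  rw [hmon]
  refine Finset.prod_congr rfl fun t _ => ?_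
  rw [aeval_bitSubst_colPow lay, aeval_bitSubst_rowPoly lay βa βb hK α Δ hc]
  have hnlt : ¬ bitsVal _ βa < K := heq ▸ lt_irrefl _
  simp [heq]

/-- **Activity of an index**: `1 − GT(·, k) = [val ≤ K]`. [cite: ChatterjeeTengse2023, Lemma 3.5 with Prop. 2.28 (v1: Lemma 42, Prop. 36) — padding of the `K+1 × K+1` matrix to `2^L × 2^L`] -/
def actPoly (a : Fin (n * δ) → τ) (Kb : Fin (n * δ) → Bool) : MvPolynomial τ F :=
  1 - GT (n * δ) (varVec a) (constVec Kb)

/-- **The encoder of the padded annihilator matrix**: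
`act(a) · act(b) · core + (1 − act(b)) · EQ(a, b)`.
[cite: ChatterjeeTengse2023, Lemma 3.5 (v1: Lemma 42; p0015.txt:L96–L99)] -/
def annEnc (x : Fin n → τ) (a b : Fin (n * δ) → τ) (Kb : Fin (n * δ) → Bool) (α : F) (Δ : ℕ)
    (U : MvPolynomial (Fin m ⊕ Fin r) F) (c : Fin n → Fin r → F) : MvPolynomial τ F :=
  actPoly a Kb * actPoly b Kb * corePoly x a b Kb α Δ U c +
    (1 - actPoly b Kb) * EQ (n * δ) (varVec a) (varVec b)

/-- **The padding of a `(K+1) × (K+1)` matrix to bit-vector indices**: the matrix on the indices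
of value `≤ K` (in the order of their values), the identity on the others, zero across.
[cite: ChatterjeeTengse2023, Lemma 3.5 with Prop. 2.28 (v1: Lemma 42, Prop. 36)] -/
def padMatrix {S : Type*} [Zero S] [One S] {L : ℕ} (K : ℕ) (M : Matrix (Fin (K + 1)) (Fin (K + 1)) S) :
    Matrix (Fin L → Bool) (Fin L → Bool) S :=
  Matrix.of fun βa βb =>
    if hb : bitsVal L βb ≤ K then
      (if ha : bitsVal L βa ≤ K then M ⟨bitsVal L βa, Nat.lt_succ_of_le ha⟩ ⟨bitsVal L βb, Nat.lt_succ_of_le hb⟩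
        else 0)
    else (if βa = βb then 1 else 0)

/-- The enumeration at the value of a bit-vector is its digit vector. [cite: ChatterjeeTengse2023, Lemma 3.5 (v1: Lemma 42; p0015.txt:L80–L82)] -/
theorem blockEnum_val (β : Fin (n * δ) → Bool) (h : bitsVal (n * δ) β < 2 ^ (n * δ)) :
    blockEnum n δ ⟨bitsVal (n * δ) β, h⟩ = blockExp n δ β := by
  have : (⟨bitsVal (n * δ) β, h⟩ : Fin (2 ^ (n * δ))) = bitsIndex (n * δ) β := Fin.ext rfl
  rw [this, blockEnum_bitsIndex]

/-- **The encoder encodes the padded `M̃`** (Lemma 3.5: "`M̃_G(x, i, j) = M̃[i, e^{(j)}]`"): with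
columns the first `K+1` digit vectors and rows the `K` Kronecker evaluations plus the symbolic row
(t18's `annMatrix`, read in the bigger ring along `x`), padded by the identity.
[cite: ChatterjeeTengse2023, Lemma 3.5 (v1: Lemma 42; p0015.txt:L74–L102, p0016.txt:L1–L8)] -/
theorem matOf_annEnc (lay : EncLayout x a b) {K : ℕ} (hK : K + 1 ≤ 2 ^ (n * δ)) (α : F) (Δ : ℕ)
    {U : MvPolynomial (Fin m ⊕ Fin r) F} {c : Fin n → Fin r → F} {G : Fin n → MvPolynomial (Fin m) F}
    (hc : ∀ t, aeval (Sum.elim X fun j => C (c t j)) U = G t) :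
    matOf a b (annEnc x a b (natBits _ K (Nat.lt_of_succ_le hK)) α Δ U c) =
      padMatrix K ((rename x).toRingHom.mapMatrix
        (annMatrix (Matrix.of fun (i : Fin K) (j : Fin (K + 1)) =>
            eval (kronPoint Δ (α ^ ((i : ℕ) + 1))) (∏ t, G t ^ blockEnum n δ (Fin.castLE hK j) t))
          (blockEnum n δ ∘ Fin.castLE hK))) := by
  have hKlt : K < 2 ^ (n * δ) := Nat.lt_of_succ_le hK
  refine Matrix.ext fun βa βb => ?_
  rw [matOf_apply', padMatrix, Matrix.of_apply]
  simp only [annEnc, actPoly, map_add, map_mul, map_sub, map_one, aeval_bitSubst_GT_const_a lay,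
    aeval_bitSubst_GT_const_b lay, aeval_bitSubst_EQ_ab lay]
  by_cases hb : bitsVal _ βb ≤ K
  · -- active column
    have hbK : ¬ K < bitsVal _ βb := not_lt.2 hb
    rw [dif_pos hb]
    simp only [hbK, decide_false, bitVal_false, sub_zero, mul_one, sub_self, zero_mul,
      add_zero]
    have hcol : blockEnum n δ (Fin.castLE hK ⟨bitsVal _ βb, Nat.lt_succ_of_le hb⟩) = blockExp n δ βb :=
      blockEnum_val βb _
    by_cases ha : bitsVal _ βa ≤ K
    · have haK : ¬ K < bitsVal _ βa := not_lt.2 ha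
      rw [dif_pos ha]
      simp only [haK, decide_false, bitVal_false, sub_zero, one_mul, RingHom.mapMatrix_apply,
        Matrix.map_apply]
      rcases ha.lt_or_eq with hlt | heq
      · -- evaluation row
        rw [aeval_bitSubst_corePoly_lt lay βa βb hKlt α Δ hc hlt]
        have hrow : (⟨bitsVal _ βa, Nat.lt_succ_of_le ha⟩ : Fin (K + 1)) =
            Fin.castSucc ⟨bitsVal _ βa, hlt⟩ := Fin.ext rfl
        rw [hrow, annMatrix_castSucc, Matrix.of_apply, hcol]
        simp
      · -- symbolic row
        rw [aeval_bitSubst_corePoly_eq lay βa βb hKlt α Δ hc heq]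
        have hrow : (⟨bitsVal _ βa, Nat.lt_succ_of_le ha⟩ : Fin (K + 1)) = Fin.last K := Fin.ext heq
        rw [hrow, annMatrix_last, Function.comp_apply, hcol]
        rfl
    · have haK : K < bitsVal _ βa := not_le.1 ha
      rw [dif_neg ha]
      simp [haK]
  · -- padding column
    have hbK : K < bitsVal _ βb := not_le.1 hb
    rw [dif_neg hb]
    simp only [hbK, decide_true, bitVal_true, sub_self, mul_zero, zero_mul, zero_add, sub_zero, one_mul]
    by_cases hab : βa = βb
    · subst hab; simp [bitVal]
    · simp [hab, bitVal]

end Encoder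

/-! ### The determinant of the padded matrix -/

section Determinant

variable {L : ℕ}

/-- The value of the bit-vector of an index. [folklore] -/
private theorem bitsVal_bitsIndex_symm (q : Fin (2 ^ L)) : bitsVal L ((bitsIndex L).symm q) = q := by
  rw [← bitsIndex_apply_val, Equiv.apply_symm_apply]

/-- Bit-vectors ordered by value: the first `K+1`, then the rest. [cite: ChatterjeeTengse2023, Lemma 3.5 with Prop. 2.28 (v1: Lemma 42, Prop. 36)] -/
def idxEquiv (L K : ℕ) (hK : K + 1 ≤ 2 ^ L) : (Fin L → Bool) ≃ Fin (K + 1) ⊕ Fin (2 ^ L - (K + 1)) :=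
  (bitsIndex L).trans ((finCongr (by omega)).trans finSumFinEquiv.symm)

/-- The first block has values `≤ K`. [folklore] -/
private theorem bitsVal_idxEquiv_symm_inl {K : ℕ} (hK : K + 1 ≤ 2 ^ L) (i : Fin (K + 1)) :
    bitsVal L ((idxEquiv L K hK).symm (Sum.inl i)) = i := by
  simp [idxEquiv, bitsVal_bitsIndex_symm]

/-- The second block has values `> K`. [folklore] -/
private theorem bitsVal_idxEquiv_symm_inr {K : ℕ} (hK : K + 1 ≤ 2 ^ L) (j : Fin (2 ^ L - (K + 1))) :
    bitsVal L ((idxEquiv L K hK).symm (Sum.inr j)) = K + 1 + j := by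
  simp [idxEquiv, bitsVal_bitsIndex_symm]

/-- **The padded matrix is `M ⊕ 1` after sorting the indices by value.**
[cite: ChatterjeeTengse2023, Lemma 3.5 with Prop. 2.28 (v1: Lemma 42, Prop. 36)] -/
theorem reindex_padMatrix {S : Type*} [Zero S] [One S] {K : ℕ} (hK : K + 1 ≤ 2 ^ L)
    (M : Matrix (Fin (K + 1)) (Fin (K + 1)) S) :
    (padMatrix (L := L) K M).reindex (idxEquiv L K hK) (idxEquiv L K hK) =
      Matrix.fromBlocks M 0 0 1 := by
  ext i j
  rw [Matrix.reindex_apply, Matrix.submatrix_apply, padMatrix, Matrix.of_apply]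
  rcases i with i | i <;> rcases j with j | j
  · have hi := bitsVal_idxEquiv_symm_inl (L := L) hK i
    have hj := bitsVal_idxEquiv_symm_inl (L := L) hK j
    have hjle : bitsVal L ((idxEquiv L K hK).symm (Sum.inl j)) ≤ K := by rw [hj]; omega
    have hile : bitsVal L ((idxEquiv L K hK).symm (Sum.inl i)) ≤ K := by rw [hi]; omega
    rw [dif_pos hjle, dif_pos hile, Matrix.fromBlocks_apply₁₁]
    congr 1 <;> exact Fin.ext (by simp [hi, hj])
  · have hj := bitsVal_idxEquiv_symm_inr (L := L) hK j
    have hjgt : ¬ bitsVal L ((idxEquiv L K hK).symm (Sum.inr j)) ≤ K := by rw [hj]; omega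
    rw [dif_neg hjgt, Matrix.fromBlocks_apply₁₂, Matrix.zero_apply, if_neg]
    intro h
    have := congrArg (bitsVal L) h
    rw [bitsVal_idxEquiv_symm_inl, hj] at this
    omega
  · have hi := bitsVal_idxEquiv_symm_inr (L := L) hK i
    have hj := bitsVal_idxEquiv_symm_inl (L := L) hK j
    have hjle : bitsVal L ((idxEquiv L K hK).symm (Sum.inl j)) ≤ K := by rw [hj]; omega
    have higt : ¬ bitsVal L ((idxEquiv L K hK).symm (Sum.inr i)) ≤ K := by rw [hi]; omega
    rw [dif_pos hjle, dif_neg higt, Matrix.fromBlocks_apply₂₁, Matrix.zero_apply]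
  · have hj := bitsVal_idxEquiv_symm_inr (L := L) hK j
    have hjgt : ¬ bitsVal L ((idxEquiv L K hK).symm (Sum.inr j)) ≤ K := by rw [hj]; omega
    rw [dif_neg hjgt, Matrix.fromBlocks_apply₂₂, Matrix.one_apply]
    by_cases h : i = j
    · subst h; simp
    · rw [if_neg, if_neg h]
      intro h'
      exact h (Sum.inr_injective ((idxEquiv L K hK).symm.injective h'))

/-- **`det` of the padded matrix is `det M`.** [cite: ChatterjeeTengse2023, Lemma 3.5 with Prop. 2.28 (v1: Lemma 42, Prop. 36)] -/
theorem det_padMatrix {S : Type*} [CommRing S] {K : ℕ} (hK : K + 1 ≤ 2 ^ L)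
    (M : Matrix (Fin (K + 1)) (Fin (K + 1)) S) : (padMatrix (L := L) K M).det = M.det := by
  rw [← Matrix.det_reindex_self (idxEquiv L K hK), reindex_padMatrix hK, Matrix.det_fromBlocks_zero₂₁,
    Matrix.det_one, mul_one]

end Determinant

/-! ### Assembly: the encoded determinant is the annihilator -/

section Assembly

variable {n m r δ : ℕ} {x : Fin n → τ} {a b : Fin (n * δ) → τ}

/-- **`det (matOf a b annEnc) = det M̃` read along `x`.**
[cite: ChatterjeeTengse2023, Lemma 3.5 (v1: Lemma 42; p0015.txt:L74–L79)] -/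
theorem det_matOf_annEnc (lay : EncLayout x a b) {K : ℕ} (hK : K + 1 ≤ 2 ^ (n * δ)) (α : F) (Δ : ℕ)
    {U : MvPolynomial (Fin m ⊕ Fin r) F} {c : Fin n → Fin r → F} {G : Fin n → MvPolynomial (Fin m) F}
    (hc : ∀ t, aeval (Sum.elim X fun j => C (c t j)) U = G t) :
    (matOf a b (annEnc x a b (natBits _ K (Nat.lt_of_succ_le hK)) α Δ U c)).det =
      rename x (annMatrix (Matrix.of fun (i : Fin K) (j : Fin (K + 1)) =>
            eval (kronPoint Δ (α ^ ((i : ℕ) + 1))) (∏ t, G t ^ blockEnum n δ (Fin.castLE hK j) t))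
          (blockEnum n δ ∘ Fin.castLE hK)).det := by
  rw [matOf_annEnc lay hK α Δ hc, det_padMatrix hK, ← RingHom.map_det]
  rfl

/-- **Lemma 3.5 (v1 Lemma 42), polynomial form, at the parameters of Thm. 3.1.** For a polynomial
map `G : F^m → F^{2m}` of degree `≤ d` (`m ≥ 2`, `d ≥ 1`, characteristic `0`) encoded by `U`
(`U(z, c_t) = g_t`), there are a block width `δ` with `2^δ ≤ 3md`, a prefix length `K`
(`K + 1 ≤ 2^{2mδ}`), a scalar `α` and a NONZERO ANNIHILATOR `A` of `G` of individual degree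
`< 2^δ` such that for EVERY layout of index blocks `a, b` (of length `2mδ`) next to the
annihilator variables `x`, the explicit encoder `annEnc` encodes a `2^{2mδ} × 2^{2mδ}` matrix
whose determinant is `A` (read along `x`).
[cite: ChatterjeeTengse2023, Lemma 3.5 with Lemma 3.2 and §3.3 (v1: Lemma 42, Lemma 39, p0015.txt:L57–L102, p0016.txt:L10–L22)] -/
theorem exists_annEnc_det_eq_annihilator [CharZero F] {d : ℕ} (hm : 2 ≤ m) (hd : 1 ≤ d)
    (G : Fin (2 * m) → MvPolynomial (Fin m) F) (hG : ∀ i, (G i).totalDegree ≤ d)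
    (U : MvPolynomial (Fin m ⊕ Fin r) F) (c : Fin (2 * m) → Fin r → F)
    (hc : ∀ t, aeval (Sum.elim X fun j => C (c t j)) U = G t) :
    ∃ (δ K : ℕ) (hK : K + 1 ≤ 2 ^ (2 * m * δ)) (α : F) (A : MvPolynomial (Fin (2 * m)) F),
      2 ^ δ ≤ 3 * m * d ∧ A ≠ 0 ∧ (∀ t, A.degreeOf t < 2 ^ δ) ∧ aeval G A = 0 ∧
      ∀ (x : Fin (2 * m) → τ) (a b : Fin (2 * m * δ) → τ), EncLayout x a b →
        (matOf a b (annEnc x a b (natBits _ K (Nat.lt_of_succ_le hK)) α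
            (2 * m * (2 ^ δ - 1) * d + 1) U c)).det = rename x A := by
  obtain ⟨δ, K, hK, α, hδ, hdet, hdeg, hann⟩ := exists_prefix_annihilator_blocks hm hd G hG
  refine ⟨δ, K, hK, α, _, hδ, hdet, hdeg, hann, fun x a b lay => ?_⟩
  exact det_matOf_annEnc lay hK α _ hc

end Assembly

end CT23Encoder

end Literature.Barriers.ValiantsHypothesis
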